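import Literature.NumberTheory.Transcendental.KZLogCalculusProofs
import Literature.NumberTheory.Transcendental.KZBallPeelingAux

/-!
# `NormalFormPrinciple` (stmt-KontsevichZagierPeriods-3869), line `SketchIdeator1` — the
# Newton–Leibniz move over the point, explicit three-generator derivation

Pure proof file (`--supports` the crux `NormalFormPrinciple` of route HurwitzMicroSectors; no
definitions). It proves the registered sub-goal `slab_sub_pt_mem_relations` — for an interval
representation `N = [(α,β), f]` whose integrand has a `ℚ`-rational primitive `F = P_F/Q_F` on
`(α,β)` (`Q_F ≠ 0` on `[α,β]`), `[N] − [pt, F(β) − F(α)] ∈ KZ.relations` — by an EXPLICIT chain of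
exactly three generators of `KZ.relations`, written out against the definitions of
`KZCalculus.lean`:

1. rule (3), ONE Newton–Leibniz move over the base `ℝ⁰` (`KZ.newtonLeibnizRel`, `n = 0`): the closed
   slab `[α,β] ⊂ ℝ¹` is the band over the point with the constant ends `α ≤ β`, the primitive is
   the explicit quotient `z ↦ P_F(z₀)/Q_F(z₀)`, so `[[α,β], f] − [pt, F(β) − F(α)]` is a generator;
2. rule (1a), ONE domain-additivity move (`KZ.domainAddRel`): the closed slab is the DISJOINT union
   of the open slab `N.domain` and of the endpoint set `E = [α,β] ∖ (α,β)`, so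
   `[[α,β], f] − [N] − [E, f]` is a generator (the integrands agree on `N.domain` by `hNi`);
3. the endpoint representation `[E, f]` is itself a relation, its domain lying in the two
   coordinate hyperplanes `{x₀ = α} ∪ {x₀ = β}` of `ℝ¹` (`KZ.of_mem_relations_of_volume_eq_zero`).

Integrability of `f` on the closed slab is the union of `N.integrableOn` (moved along `hNi`) with
the trivial integrability on the null endpoint set; no passage through `ℝ¹ ≃ ℝ`, no interval
integral and no `IntegralRep.restrict` is used.

Source: M. Kontsevich, D. Zagier, *Periods*, in: Mathematics Unlimited — 2001 and Beyond
(Springer, 2001), §1.2, rules (1) and (3).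
-/

noncomputable section

open MeasureTheory Set
open scoped Polynomial
open Literature.NumberTheory.Transcendental Literature.NumberTheory.Transcendental.KZ
open Literature.ModelTheory.ExponentialFields (IsSemialgebraic isSemialgebraic_univ
  isSemialgebraic_setOf_eval_le)

namespace Summit.KontsevichZagierPeriods.HurwitzMicroSectors.NormalFormPrinciple.SlabElementaryK6

/-- **Newton–Leibniz over the point** (Kontsevich–Zagier rule (3), with the null endpoints removed
by rule (1a)). Let `α ≤ β` be rational, `N = [(α,β), f]` an interval representation whose integrand
`x ↦ f(x₀)` is `ℚ`-semialgebraic on the closed slab `[α,β] ⊂ ℝ¹`, and `F = P_F/Q_F`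
(`P_F, Q_F ∈ ℚ[X]`, `Q_F ≠ 0` on `[α,β]`) a primitive of `f` on `(α,β)`. Then
`[N] − [pt, F(β) − F(α)] ∈ KZ.relations` for every point representation `Z = [pt, F(β) − F(α)]`
over `ℝ⁰`. Proof: `[N] − [Z] = ([[α,β],f] − [Z]) − ([[α,β],f] − [N] − [E,f]) − [E,f]` with
`E = [α,β] ∖ (α,β)`: one generator of `newtonLeibnizRel`, one of `domainAddRel`, one null
representation. [cite: KontsevichZagier2001, §1.2 rule (3)] -/
theorem slab_sub_pt_mem_relations {α β : ℚ} (hαβ : α ≤ β) (f : ℝ → ℝ) (PF QF : ℚ[X])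
    (hQF : ∀ t ∈ Set.Icc (α:ℝ) β, (Polynomial.aeval t QF : ℝ) ≠ 0)
    (hderiv : ∀ t ∈ Set.Ioo (α:ℝ) β,
      HasDerivAt (fun u : ℝ => (Polynomial.aeval u PF : ℝ) / Polynomial.aeval u QF) (f t) t)
    (hf : IsSemialgebraicFunOn ℚ {x : Fin 1 → ℝ | x 0 ∈ Set.Icc (α:ℝ) β} (fun x => f (x 0)))
    (N : IntegralRep 1) (hNd : N.domain = {x | x 0 ∈ Set.Ioo (α:ℝ) β})
    (hNi : EqOn N.integrand (fun x => f (x 0)) N.domain)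
    (Z : IntegralRep 0) (hZd : Z.domain = univ)
    (hZi : Z.integrand = fun _ => (Polynomial.aeval (β:ℝ) PF : ℝ) / Polynomial.aeval (β:ℝ) QF -
      (Polynomial.aeval (α:ℝ) PF : ℝ) / Polynomial.aeval (α:ℝ) QF) :
    of N - of Z ∈ relations := by
  have hαβ' : (α:ℝ) ≤ β := by exact_mod_cast hαβ
  /- the closed slab `[α,β] ⊂ ℝ¹` is `ℚ`-semialgebraic: two polynomial inequalities -/
  have hCsa : IsSemialgebraic ℚ {x : Fin 1 → ℝ | x 0 ∈ Set.Icc (α:ℝ) β} := by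
    have hset : {x : Fin 1 → ℝ | x 0 ∈ Set.Icc (α:ℝ) β} =
        {x | MvPolynomial.aeval x (MvPolynomial.C α : MvPolynomial (Fin 1) ℚ) ≤
            MvPolynomial.aeval x (MvPolynomial.X 0 : MvPolynomial (Fin 1) ℚ)} ∩
          {x | MvPolynomial.aeval x (MvPolynomial.X 0 : MvPolynomial (Fin 1) ℚ) ≤
            MvPolynomial.aeval x (MvPolynomial.C β : MvPolynomial (Fin 1) ℚ)} := by
      ext x
      simp
    rw [hset]
    exact (isSemialgebraic_setOf_eval_le _ _).inter (isSemialgebraic_setOf_eval_le _ _)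
  /- the open slab `N.domain` lies in the closed one, and the endpoint set is Lebesgue-null -/
  have hNC : N.domain ⊆ {x : Fin 1 → ℝ | x 0 ∈ Set.Icc (α:ℝ) β} := by
    rw [hNd]
    exact fun x hx => Set.Ioo_subset_Icc_self hx
  have hEnull : volume ({x : Fin 1 → ℝ | x 0 ∈ Set.Icc (α:ℝ) β} \ N.domain) = 0 := by
    refine measure_mono_null (fun x hx => ?_)
      (measure_union_null (BallPeeling.volume_setOf_apply_eq_const 1 0 (α:ℝ))
        (BallPeeling.volume_setOf_apply_eq_const 1 0 (β:ℝ)))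
    simp only [hNd, Set.mem_sdiff, Set.mem_setOf_eq, Set.mem_Icc, Set.mem_Ioo, not_and,
      not_lt] at hx
    obtain ⟨⟨h1, h2⟩, h3⟩ := hx
    show x 0 = (α:ℝ) ∨ x 0 = (β:ℝ)
    rcases h1.eq_or_lt with h | h
    · exact Or.inl h.symm
    · exact Or.inr (le_antisymm h2 (h3 h))
  /- `f` is integrable on the closed slab: it is `N.integrand` on the open slab, the rest is null -/
  have hCeq : {x : Fin 1 → ℝ | x 0 ∈ Set.Icc (α:ℝ) β} =
      N.domain ∪ ({x : Fin 1 → ℝ | x 0 ∈ Set.Icc (α:ℝ) β} \ N.domain) :=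
    (Set.union_sdiff_cancel hNC).symm
  have hfC : IntegrableOn (fun x : Fin 1 → ℝ => f (x 0))
      {x : Fin 1 → ℝ | x 0 ∈ Set.Icc (α:ℝ) β} := by
    rw [hCeq]
    exact (N.integrableOn.congr_fun hNi (IntegralRep.measurableSet_domain_holds N)).union
      (IntegrableOn.of_measure_zero hEnull)
  /- the closed-slab representation `R = [[α,β], f]` and the endpoint representation `E` -/
  obtain ⟨R, hRd, hRi⟩ : ∃ R : IntegralRep 1,
      R.domain = {x : Fin 1 → ℝ | x 0 ∈ Set.Icc (α:ℝ) β} ∧ R.integrand = fun x => f (x 0) :=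
    ⟨⟨_, _, hCsa, hf, hfC⟩, rfl, rfl⟩
  have hEsa : IsSemialgebraic ℚ ({x : Fin 1 → ℝ | x 0 ∈ Set.Icc (α:ℝ) β} \ N.domain) :=
    hCsa.diff N.isSemialgebraic_domain
  obtain ⟨E, hEd, hEi⟩ : ∃ E : IntegralRep 1,
      E.domain = {x : Fin 1 → ℝ | x 0 ∈ Set.Icc (α:ℝ) β} \ N.domain ∧
        E.integrand = fun x => f (x 0) :=
    ⟨⟨_, _, hEsa, hf.mono Set.sdiff_subset hEsa, IntegrableOn.of_measure_zero hEnull⟩, rfl, rfl⟩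
  /- generator of rule (1a): `[R] − [N] − [E]`, a disjoint decomposition of the closed slab -/
  have h1a : of R - of N - of E ∈ relations := by
    refine domainAddRel_subset_relations ⟨1, R, N, E, ?_, ?_, ?_, ?_, rfl⟩
    · rw [hRd, hEd]
      exact hCeq
    · rw [hEd, Set.inter_sdiff_self]
      exact measure_empty
    · intro x hx
      rw [hRi]
      exact (hNi hx).symm
    · intro x _
      rw [hRi, hEi]
  /- the endpoint representation has a null domain, hence is a relation -/
  have hE : of E ∈ relations :=
    of_mem_relations_of_volume_eq_zero E (by rw [hEd]; exact hEnull)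
  /- generator of rule (3): ONE Newton–Leibniz move over the point, primitive `P_F(z₀)/Q_F(z₀)` -/
  have hs0 : ∀ (x : Fin 0 → ℝ) (t : ℝ), (Fin.snoc x t : Fin 1 → ℝ) 0 = t := fun _ _ => rfl
  have hX : ∀ (A : ℚ[X]) (x : Fin 1 → ℝ), MvPolynomial.aeval x
      (Polynomial.aeval (MvPolynomial.X 0 : MvPolynomial (Fin 1) ℚ) A) =
        (Polynomial.aeval (x 0) A : ℝ) := fun A x => by
    rw [← Polynomial.aeval_algHom_apply, MvPolynomial.aeval_X]
  have h3 : of R - of Z ∈ relations := by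
    refine newtonLeibnizRel_subset_relations ⟨0, R, Z, fun _ => (α:ℝ), fun _ => (β:ℝ),
      fun z => (Polynomial.aeval (z 0) PF : ℝ) / Polynomial.aeval (z 0) QF,
      ?_, ?_, ?_, fun _ _ => hαβ', ?_, ?_, ?_, ?_, rfl⟩
    · -- the primitive: a quotient of `ℚ`-polynomials in `z₀`, denominator `≠ 0` on the slab
      rw [hRd]
      refine (isSemialgebraicFunOn_aeval_div_aeval hCsa
        (Polynomial.aeval (MvPolynomial.X 0 : MvPolynomial (Fin 1) ℚ) PF)
        (Polynomial.aeval (MvPolynomial.X 0 : MvPolynomial (Fin 1) ℚ) QF) fun x hx => ?_).congr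
        fun x _ => ?_
      · rw [hX]
        exact hQF (x 0) hx
      · simp only [hX]
    · -- the lower end `α` (a rational constant on `ℝ⁰`)
      rw [hZd]
      simpa using isSemialgebraicFunOn_aeval (isSemialgebraic_univ (k := ℚ) (ι := Fin 0) (R := ℝ))
        (MvPolynomial.C α)
    · -- the upper end `β`
      rw [hZd]
      simpa using isSemialgebraicFunOn_aeval (isSemialgebraic_univ (k := ℚ) (ι := Fin 0) (R := ℝ))
        (MvPolynomial.C β)
    · -- the closed slab is the band over the point with the constant ends `α ≤ β`
      rw [hRd, hZd]
      ext z
      simp only [Set.mem_setOf_eq, Set.mem_Icc, Set.mem_univ, true_and]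
      rfl
    · -- the primitive is continuous on the closed fibre (`Q_F ≠ 0` there)
      intro x _
      simp only [hs0]
      exact (Polynomial.continuous_aeval PF).continuousOn.div
        (Polynomial.continuous_aeval QF).continuousOn hQF
    · -- and differentiates to the integrand `f` on the open fibre
      intro x _ t ht
      rw [hRi]
      simp only [hs0]
      exact hderiv t ht
    · -- the point representation carries `F(β) − F(α)`
      intro x _
      simp only [hZi, hs0]
  /- bookkeeping in the free abelian group `FormalRep` -/
  have key : of N - of Z = (of R - of Z) - (of R - of N - of E) - of E := by abel
  rw [key]
  exact relations.sub_mem (relations.sub_mem h3 h1a) hE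

end Summit.KontsevichZagierPeriods.HurwitzMicroSectors.NormalFormPrinciple.SlabElementaryK6
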